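import Literature.Claims.NS.Godoi2016
import Literature.Analysis.FluidPDE.ClaySettingParasiticDrift
import HarnessLib

/-!
# SoloRefute — C131 `Godoi2016` (D-0090 NS-CLAIMS SWEEP; refuter ns-claims-refuter-2 g2)

Row C131: V. M. dos Santos Godoi, «Three Examples of Unbounded Energy for t > 0», J. Phys. Math. 7(3)
(2016) art. 1000196, doi:10.4172/2090-0902.1000196 (10 pp., PDF page = printed page) = bib `Godoi2016`;
typed skeleton `Literature.Claims.NS.Godoi2016` (typist-12 g2, p493052). T3 QUICK statement grain.

KILL ROUTE 3 (explicit countermodel to the step AS PRINTED; README «KILL ROUTES» §3 — Galilean /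
parasitic drift family, tree file `Literature/Analysis/FluidPDE/ClaySettingParasiticDrift.lean`,
Koch–Nadirashvili–Seregin–Šverák 2009 §1), at the paper's OWN simplest data.

FIRST FAILING STEP (refuter's reading; the VERDICT line on the cell bus is the word of record):
`Literature.Claims.NS.Godoi2016.UniqLocal` / its instance `UniqAt ν 0 0` = the uniqueness paragraph,
PDF p.8 col.2 (pages/p008.txt l.85–113: «So we need that exists uniqueness of solution for the velocity
that we build, eliminating other possible velocitys for the same data used, u⁰(x) and f(x,t) … The
uniqueness of the solution (except due the pressure …) comes from classical results already known, for
example described in the mentioned article of Fefferman [1]: the system of Navier-Stokes equations (1),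
(2), (3) it has unique solution for all t ≥ 0 or only for a finite time interval [0,T) … the uniqueness
would exist in at least a small interval of time, which is enough to show that in this time range occurs
the breakdown of Navier-Stokes solutions …»). It is the hypothesis the skeleton's own composition
consumes: `claim_of_uniqAt_zero : (∀ ν > 0, UniqAt ν 0 0) → ClaimedTheorem` (= Clay (C),
`claimedTheorem_iff_clayC`).

WITNESS (all faces): datum `u⁰ ≡ 0` («Simpler it would be to choose u⁰(x) = 0», PDF p.2 col.2, pages/p002.txt
l.94 — the paper's printed option inside Example 1; then (13.4) gives `f ≡ 0`, skeleton `force1_zero`),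
force `f ≡ 0`, any viscosity `ν`: TWO solutions of (1)(2)(3), smooth on `ℝ³ × [0,∞)`, with these data whose
velocities differ at every `t > 0` — the rest state `(0, 0)` and the paper's own Example-1 velocity
`u = v(t) = e^{−t}(1 − e^{−t})(1,1,1)`, `p = −w′(t)(x₁+x₂+x₃)` (skeleton `example1_zero`,
`velocity1_zero : velocity1 0 = driftVelocity drift`); second, tree-only witness pair: rest state vs the
KNSS drift `u = t e₀`, `p = −x₀` (`Literature.Analysis.FluidPDE.exists_parasitic_solution_zero_datum`).
Hence no uniqueness window `[0,T)`, `T > 0`: `¬ UniqAt ν 0 0` for every `ν`, so `¬ UniqLocal`,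
`¬ UniqGlobal`, and `¬ ∀ ν > 0, UniqAt ν 0 0` (the exact hypothesis of `claim_of_uniqAt_zero`).
Moreover the paper's CONCLUSION at this witness is false in the kernel: the data `(0, 0)` ADMIT a
Clay-sense solution (the rest state, bounded energy with `C = 0`): `solvable_zero`,
`not_NoAdmissibleSolution_zero` — so no retyping of Step 2 rescues the inference «one solution violating
(7) ⇒ no solution with (7)» at the paper's simplest witness.

CLASS CANDIDATE: false lemma (countermodel) at the printed class (uniqueness of the velocity among smooth
solutions of (1)(2)(3)(6) with the same `(u⁰, f)`, NO energy condition (7) on the competitors — the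
sentence names (1)(2)(3) only and is applied to the paper's own infinite-energy `u`). Charitable retype
for the referee (uniqueness among solutions WITH (7): classical weak–strong territory) does not apply to
the paper's `u` (`∫|u(t)|² = ∞` for `t > 0`, skeleton `example1_zero`) and leaves Step 3 a non-sequitur;
at the witness `(0,0)` the conclusion itself is refuted (`not_NoAdmissibleSolution_zero`). STATEMENT delta
to Clay (C): none (`claimedTheorem_iff_clayC`).

PROVENANCE: faces `restState_solves`, `not_UniqAt_zero`, `not_UniqLocal`, `not_UniqGlobal`,
`solvable_zero`, `not_NoAdmissibleSolution_zero` = typist-12 g2's kill-aid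
`claims/Godoi2016/KillKit-Godoi2016-typist12.lean` (sha16 c3798675fbeb4167, NOT filed by the typist)
ADOPTED VERBATIM by the named refuter after independent reading (the refuter's sealed PREDICTED-R
0d2b302b97c461b1, 2026-08-27T03:30Z, names this step and this drift pair); faces
`not_UniqAt_zero_knss`, `not_forall_uniqAt_zero`, `not_UniqLocal_knss` = refuter-2 g2 (second witness
pair from the tree's KNSS drift, independent of the paper's profile `w`). Axioms: propext,
Classical.choice, Quot.sound.

WHAT THIS IS NOT: not a claim about NS regularity or blow-up; not a claim about any author beyond the
typed locator.
-/

set_option linter.dupNamespace false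

noncomputable section

namespace Summit.NavierStokesRegularity.NavierStokesRegularity.Theorems.Godoi2016

open Set MeasureTheory
open scoped ContDiff ENNReal
open Literature.Analysis.FluidPDE Literature.Claims.NS.ClayVariants Literature.Claims.NS.Godoi2016

/-- The zero time profile: the rest state is the drift with `b ≡ 0`. [folklore] -/
private theorem contDiff_zeroProfile : ContDiff ℝ ∞ (fun _ : ℝ => (0 : R3)) := contDiff_const

/-- The rest state `(u, p) = (0, −⟪0′, x⟫) = (0, 0)` solves (1)(2)(3) with force `0`, datum `0`, and is
smooth on `ℝ³ × [0,∞)` (drift tool-kit with the zero profile). [cite: FeffermanClay2006, (1)–(3) (6)] -/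
theorem restState_solves (ν : ℝ) :
    IsNavierStokesSolution ν 0 0 (driftVelocity fun _ : ℝ => (0 : R3)) (driftPressure fun _ : ℝ => (0 : R3)) ∧
      IsSmoothOnHalfSpace (driftVelocity fun _ : ℝ => (0 : R3)) ∧
        IsSmoothOnHalfSpace (driftPressure fun _ : ℝ => (0 : R3)) := by
  have h := isNavierStokesSolution_drift (contDiff_zeroProfile.of_le (by exact_mod_cast le_top)) ν
  exact ⟨h, isSmoothOnHalfSpace_driftVelocity contDiff_zeroProfile,
    isSmoothOnHalfSpace_driftPressure contDiff_zeroProfile⟩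

/-- **KILL (Step 2 at the paper's simplest data): `¬ UniqAt ν 0 0` for every `ν`.** Two solutions of
(1)(2)(3), smooth on `ℝ³ × [0,∞)`, from the datum `u⁰ ≡ 0` with force `f ≡ 0`, whose velocities differ at
EVERY `t > 0`: the rest state and the paper's own Example 1 with `u⁰ ≡ 0` («Simpler it would be to choose
u⁰(x) = 0», PDF p.2 col.2), `u = v(t) = e^{−t}(1 − e^{−t})(1,1,1)`, `p = −w′(t)(x₁+x₂+x₃)` — so no `T > 0`
with equal velocities on `[0,T)` exists. [cite: Godoi2016, p.8 col.2 (uniqueness ¶); (13.1)–(16) p.2 col.2] -/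
theorem not_UniqAt_zero (ν : ℝ) : ¬ UniqAt ν 0 0 := by
  intro h
  obtain ⟨-, -, -, -, -, hu, hp, hns, -⟩ := example1_zero ν
  rw [force1_zero] at hns
  obtain ⟨hrest, hv, hq⟩ := restState_solves ν
  obtain ⟨T, hT, heq⟩ := h (velocity1 0) (driftVelocity fun _ : ℝ => (0 : R3)) (pressure1 0)
    (driftPressure fun _ : ℝ => (0 : R3)) hu hp hns hv hq hrest
  have h1 := congrFun (heq (T / 2) ⟨by positivity, by linarith⟩) 0
  rw [velocity1_zero] at h1
  exact drift_ne_zero (by positivity : (0 : ℝ) < T / 2) h1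

/-- **KILL (Step 2, sentence grain): `¬ UniqLocal`** — instantiate at `ν = 1`, `u⁰ ≡ 0` (a Clay datum),
`f ≡ 0` (a Clay force). [cite: Godoi2016, p.8 col.2 (uniqueness ¶)] -/
theorem not_UniqLocal : ¬ UniqLocal := by
  intro h
  obtain ⟨hd, hdiv, hdec, -, -⟩ := example1_zero 1
  exact not_UniqAt_zero 1 (h 1 one_pos 0 0 hd hdiv hdec isSmoothOnHalfSpace_zero clayR3_force_zero)

/-- **KILL (Step 2, global grain): `¬ UniqGlobal`.** [cite: Godoi2016, p.8 col.2 ¶3] -/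
theorem not_UniqGlobal : ¬ UniqGlobal := fun h => not_UniqLocal (uniqLocal_of_uniqGlobal h)

/-- **The conclusion at the paper's simplest witness is false**: the data `(u⁰, f) = (0, 0)` of Example 1
with «u⁰(x) = 0» ADMIT a Clay-sense solution — the rest state (smooth, solves (1)(2)(3), bounded energy
(7) with `C = 0`). [cite: Godoi2016, Conclusion p.8 col.1; p.2 col.2] -/
theorem solvable_zero (ν : ℝ) : clayR3.Solvable ν 0 0 := by
  obtain ⟨hrest, hv, hq⟩ := restState_solves ν
  refine ⟨_, _, hv, hq, hrest, ?_⟩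
  show HasBoundedEnergy (driftVelocity fun _ : ℝ => (0 : R3))
  exact ⟨0, ENNReal.zero_lt_top, fun t _ => by simp [driftVelocity]⟩

/-- `¬ NoAdmissibleSolution ν 0 0`. [cite: Godoi2016, Conclusion p.8 col.1] -/
theorem not_NoAdmissibleSolution_zero (ν : ℝ) : ¬ NoAdmissibleSolution ν 0 0 :=
  fun h => h (solvable_zero ν)


/-! ## Second witness pair (tree only): rest state vs the KNSS drift `t e₀` -/

/-- **`¬ UniqAt ν 0 0`, tree-only witness pair**: the rest state `(0,0)` and the parasitic drift
`u(t,x) = t e₀`, `p(t,x) = −x₀` of `Literature.Analysis.FluidPDE.exists_parasitic_solution_zero_datum`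
are two solutions of (1)(2)(3), smooth on `ℝ³ × [0,∞)`, from datum `0` with force `0`; the drift has
`‖u(t)‖_{L²} = ∞` at every `t ≠ 0` while the rest state has `‖0‖_{L²} = 0`, so the velocities differ on
every window `[0,T)`, `T > 0`. Independent of the paper's profile `w` (13.2).
[cite: KochNadirashviliSereginSverak2009, §1 (arXiv p. 3)] [cite: Godoi2016, p.8 col.2 (uniqueness ¶)] -/
theorem not_UniqAt_zero_knss (ν : ℝ) : ¬ UniqAt ν 0 0 := by
  intro h
  obtain ⟨u, p, hns, hu, hp, htop, -⟩ := exists_parasitic_solution_zero_datum ν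
  obtain ⟨hrest, hv, hq⟩ := restState_solves ν
  obtain ⟨T, hT, heq⟩ := h u (driftVelocity fun _ : ℝ => (0 : R3)) p
    (driftPressure fun _ : ℝ => (0 : R3)) hu hp hns hv hq hrest
  have hmem : T / 2 ∈ Ico 0 T := ⟨by positivity, by linarith⟩
  have h1 := htop (T / 2) (by positivity : (0 : ℝ) < T / 2).ne'
  have hz : eLpNorm (driftVelocity (fun _ : ℝ => (0 : R3)) (T / 2)) 2 volume = 0 := by
    rw [show driftVelocity (fun _ : ℝ => (0 : R3)) (T / 2) = fun _ : R3 => (0 : R3) from rfl]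
    simp
  rw [heq (T / 2) hmem, hz] at h1
  exact ENNReal.zero_ne_top h1

/-- **The hypothesis of the skeleton's composition is false**: `¬ ∀ ν > 0, UniqAt ν 0 0` — exactly the
antecedent of `Literature.Claims.NS.Godoi2016.claim_of_uniqAt_zero` (Step 2 at the paper's simplest
data, the only input the (C) conclusion consumes once Example 1 with `u⁰ ≡ 0` is proved).
[cite: Godoi2016, p.8 col.2 (uniqueness ¶); p.2 col.2 «Simpler it would be to choose u⁰(x) = 0»] -/
theorem not_forall_uniqAt_zero : ¬ ∀ ν : ℝ, 0 < ν → UniqAt ν 0 0 :=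
  fun h => not_UniqAt_zero_knss 1 (h 1 one_pos)

/-- **`¬ UniqLocal` through the tree-only pair** (datum `0` is a Clay datum, force `0` a Clay force:
`clayDatum_zero`, `isSmoothOnHalfSpace_zero`, `clayR3_force_zero`). [cite: Godoi2016, p.8 col.2] -/
theorem not_UniqLocal_knss : ¬ UniqLocal := by
  intro h
  obtain ⟨hd, hdiv, hdec⟩ := clayDatum_zero
  exact not_UniqAt_zero_knss 1 (h 1 one_pos 0 0 hd hdiv hdec isSmoothOnHalfSpace_zero clayR3_force_zero)

end Summit.NavierStokesRegularity.NavierStokesRegularity.Theorems.Godoi2016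

end

-- WHAT THIS IS NOT: not a claim about NS regularity or blow-up; not a claim about any author beyond the
-- typed locator.
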